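import Mathlib
import Literature.MathematicalPhysics.QuantumLattice.TorusCooperSum
import HarnessLib

/-!
# Weyl law for the square-lattice torus band

Topic `MathematicalPhysics/QuantumLattice`. For the nearest-neighbour band
`ε_L(k) = torusBand L k = -2 Σᵢ cos(2πkᵢ/L)` of the `L × L` torus (`HubbardFreePropagator.lean`)
and its level-counting function `torusLevelCount L E = #{k ∈ (ℤ/Lℤ)² | ε_L(k) ≤ E}`
(`TorusCooperSum.lean`) we PROVE the Weyl law

  `torusLevelCount L E / L² → vol {v ∈ [0,1)² | -2(cos 2πv₁ + cos 2πv₂) ≤ E}`  (`L → ∞`),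

(`tendsto_torusLevelCount_div_sq`, stated along `L + 1` because `torusLevelCount` needs
`[NeZero L]`): the fraction of torus momenta below an energy converges to the integrated density
of states of the tight-binding band, i.e. the Lebesgue measure of the sublevel set of the band
function on the unit cell of reciprocal space. Ingredients, all proved here:

* `volume_unitCellBand_eq` — every level set `{band = E}` is Lebesgue-null (each horizontal slice
  `{y | cos 2πy = c}` is countable, `Real.cos_eq_cos_iff`; Tonelli via `Measure.measure_prod_null`);
* `volume_frontier_unitCellSublevel` — hence the sublevel cell `{v ∈ [0,1)² | band v ≤ E}` is
  Jordan measurable (its frontier lies in `{band = E}` plus the null boundary of the cell);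
* `card_unitCellSublevel_inter_lattice` — the sublevel cell meets the scaled lattice `L⁻¹ℤ²`
  exactly in the points `(kᵢ.val/L)ᵢ` of the momenta counted by `torusLevelCount L E`;
* Mathlib's lattice-point counting theorem `tendsto_card_div_pow_atTop_volume`
  (`Mathlib.Analysis.BoxIntegral.UnitPartition`).

No definition is introduced: the integrated density of states is written as the explicit volume
`volume.real {v : Fin 2 → ℝ | (∀ i, v i ∈ Ico 0 1) ∧ -2 Σᵢ cos(2π vᵢ) ≤ E}`; it equals
`KohnLuttinger.filling (squareDispersion 1 0) E / 2` of `KohnLuttinger.lean` up to the change of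
variables `p = 2πv - π·(1,1)`-periodicity and the null level set (not proved here).
Companions: `TorusBandIntegratedDensity.lean` (monotonicity and continuity in `E`),
`TorusBandFillingWindow.lean` (an explicit energy window realising the fillings `[3/10, 9/20]`).

References: H. Weyl (1912) / lattice-point counting in Jordan domains (folklore; e.g.
Friedli–Velenik, *Statistical Mechanics of Lattice Systems* (2017) §B.; tree convention for the
band: Benfatto–Giuliani–Mastropietro, AHP 7 (2006) 809, eq. (1.4)).
-/

noncomputable section

open MeasureTheory Submodule Filter Topology Bornology Finset
open Literature.Probability.LatticeModels
open scoped Pointwise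

namespace Literature.MathematicalPhysics.QuantumLattice


/-! ### The band function on the unit cell -/

/-- The band function of the unit cell is continuous. [folklore] -/
theorem continuous_unitCellBand :
    Continuous (fun v : Fin 2 → ℝ => -2 * ∑ i : Fin 2, Real.cos (2 * Real.pi * v i)) := by
  refine continuous_const.mul (continuous_finsetSum _ fun i _ => ?_)
  exact Real.continuous_cos.comp (continuous_const.mul (continuous_apply i))

/-- The solutions of `cos (2π y) = c` form a countable set. [folklore] -/
theorem countable_cos_two_pi_mul_eq (c : ℝ) : {y : ℝ | Real.cos (2 * Real.pi * y) = c}.Countable := by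
  by_cases h : ∃ y₀ : ℝ, Real.cos (2 * Real.pi * y₀) = c
  · obtain ⟨y₀, hy₀⟩ := h
    have hsub : {y : ℝ | Real.cos (2 * Real.pi * y) = c} ⊆
        Set.range (fun p : ℤ × Bool => if p.2 then (p.1 : ℝ) + y₀ else (p.1 : ℝ) - y₀) := by
      intro y hy
      simp only [Set.mem_setOf_eq] at hy
      rw [← hy₀] at hy
      obtain ⟨k, hk⟩ := Real.cos_eq_cos_iff.1 hy.symm
      have hπ : Real.pi ≠ 0 := Real.pi_ne_zero
      rcases hk with hk | hk
      · refine ⟨(k, true), ?_⟩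
        simp only [ite_true]
        have : 2 * Real.pi * (y - (k + y₀)) = 0 := by linarith
        have h2 : y - (k + y₀) = 0 := by
          rcases mul_eq_zero.1 this with h | h
          · exact absurd h (by positivity)
          · exact h
        linarith
      · refine ⟨(k, false), ?_⟩
        simp only [Bool.false_eq_true, ite_false]
        have : 2 * Real.pi * (y - (k - y₀)) = 0 := by linarith
        have h2 : y - (k - y₀) = 0 := by
          rcases mul_eq_zero.1 this with h | h
          · exact absurd h (by positivity)
          · exact h
        linarith
    exact (Set.countable_range _).mono hsub
  · have : {y : ℝ | Real.cos (2 * Real.pi * y) = c} = ∅ := by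
      ext y
      simp only [Set.mem_setOf_eq, Set.mem_empty_iff_false, iff_false]
      exact fun hy => h ⟨y, hy⟩
    rw [this]
    exact Set.countable_empty

/-- **The level sets of the band function are Lebesgue-null.** [folklore] -/
theorem volume_unitCellBand_eq (E : ℝ) :
    volume {v : Fin 2 → ℝ | -2 * ∑ i : Fin 2, Real.cos (2 * Real.pi * v i) = E} = 0 := by
  set T : Set (ℝ × ℝ) := {p | -2 * (Real.cos (2 * Real.pi * p.1) + Real.cos (2 * Real.pi * p.2)) = E}
    with hT
  have hTm : MeasurableSet T := by
    refine measurableSet_eq_fun ?_ measurable_const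
    refine measurable_const.mul (Measurable.add ?_ ?_)
    · exact Real.measurable_cos.comp (measurable_const.mul measurable_fst)
    · exact Real.measurable_cos.comp (measurable_const.mul measurable_snd)
  have hpre : {v : Fin 2 → ℝ | -2 * ∑ i : Fin 2, Real.cos (2 * Real.pi * v i) = E} =
      MeasurableEquiv.finTwoArrow ⁻¹' T := by
    ext v
    simp [hT, Fin.sum_univ_two, MeasurableEquiv.finTwoArrow_apply]
  rw [hpre, (volume_preserving_finTwoArrow ℝ).measure_preimage hTm.nullMeasurableSet,
    Measure.volume_eq_prod, Measure.measure_prod_null hTm]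
  refine Filter.Eventually.of_forall fun x => ?_
  simp only [Pi.zero_apply]
  have hslice : Prod.mk x ⁻¹' T =
      {y : ℝ | Real.cos (2 * Real.pi * y) = -E / 2 - Real.cos (2 * Real.pi * x)} := by
    ext y
    simp only [hT, Set.mem_preimage, Set.mem_setOf_eq]
    constructor <;> intro h <;> linarith
  rw [hslice]
  exact (countable_cos_two_pi_mul_eq _).measure_zero _

/-- The unit cell `[0,1)²` as a product set. [folklore] -/
theorem unitCell_eq_pi :
    {v : Fin 2 → ℝ | ∀ i, v i ∈ Set.Ico (0 : ℝ) 1} = Set.univ.pi fun _ : Fin 2 => Set.Ico (0 : ℝ) 1 := by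
  ext v; simp

/-- The boundary of the unit cell is Lebesgue-null. [folklore] -/
theorem volume_frontier_unitCell :
    volume (frontier {v : Fin 2 → ℝ | ∀ i, v i ∈ Set.Ico (0 : ℝ) 1}) = 0 := by
  rw [unitCell_eq_pi]
  have hsub : frontier (Set.univ.pi fun _ : Fin 2 => Set.Ico (0 : ℝ) 1) ⊆
      ⋃ i : Fin 2, ({v : Fin 2 → ℝ | v i = 0} ∪ {v | v i = 1}) := by
    intro v hv
    rw [frontier, closure_pi_set, interior_pi_set Set.finite_univ] at hv
    obtain ⟨hcl, hint⟩ := hv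
    simp only [closure_Ico zero_ne_one, interior_Ico, Set.mem_univ_pi, Set.mem_Icc,
      Set.mem_Ioo, not_forall] at hcl hint
    obtain ⟨i, hi⟩ := hint
    refine Set.mem_iUnion.2 ⟨i, ?_⟩
    have h1 := hcl i
    simp only [Set.mem_union, Set.mem_setOf_eq]
    by_contra hne
    push Not at hne
    exact hi ⟨lt_of_le_of_ne h1.1 (Ne.symm hne.1), lt_of_le_of_ne h1.2 hne.2⟩
  refine measure_mono_null hsub ?_
  refine (measure_iUnion_null_iff).2 fun i => ?_
  rw [measure_union_null_iff]
  constructor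
  · rw [volume_pi]; exact Measure.pi_hyperplane _ i 0
  · rw [volume_pi]; exact Measure.pi_hyperplane _ i 1

/-- **The frontier of a sublevel cell `{v ∈ [0,1)² | ε(2πv) ≤ E}` is Lebesgue-null.** [folklore] -/
theorem volume_frontier_unitCellSublevel (E : ℝ) :
    volume (frontier {v : Fin 2 → ℝ | (∀ i, v i ∈ Set.Ico (0 : ℝ) 1) ∧
      -2 * ∑ i : Fin 2, Real.cos (2 * Real.pi * v i) ≤ E}) = 0 := by
  have hsplit : {v : Fin 2 → ℝ | (∀ i, v i ∈ Set.Ico (0 : ℝ) 1) ∧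
      -2 * ∑ i : Fin 2, Real.cos (2 * Real.pi * v i) ≤ E} =
      {v : Fin 2 → ℝ | ∀ i, v i ∈ Set.Ico (0 : ℝ) 1} ∩
        {v | -2 * ∑ i : Fin 2, Real.cos (2 * Real.pi * v i) ≤ E} := by
    ext v; simp
  rw [hsplit]
  refine measure_mono_null (frontier_inter_subset _ _) ?_
  rw [measure_union_null_iff]
  constructor
  · exact measure_mono_null Set.inter_subset_left volume_frontier_unitCell
  · refine measure_mono_null Set.inter_subset_right ?_
    refine measure_mono_null (frontier_le_subset_eq continuous_unitCellBand continuous_const) ?_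
    exact volume_unitCellBand_eq E

/-! ### Lattice momenta as points of the scaled integer lattice -/

section Lattice

variable {L : ℕ} [NeZero L]

/-- Membership in the scaled integer lattice `L⁻¹ℤ²` (as a set), coordinatewise. [folklore] -/
theorem mem_smul_coe_span_iff {v : Fin 2 → ℝ} :
    v ∈ (L : ℝ)⁻¹ • ((span ℤ (Set.range (Pi.basisFun ℝ (Fin 2))) : Submodule ℤ (Fin 2 → ℝ))
      : Set (Fin 2 → ℝ)) ↔ ∀ i, (L : ℝ) * v i ∈ Set.range (algebraMap ℤ ℝ) := by
  rw [← Submodule.coe_pointwise_smul, SetLike.mem_coe]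
  exact BoxIntegral.unitPartition.mem_smul_span_iff

/-- The point of the unit cell attached to a torus momentum, `k ↦ (k_i.val / L)_i`, is injective
in `k`. [folklore] -/
theorem unitCellPoint_injective :
    Function.Injective (fun k : TorusSite 2 L => fun i : Fin 2 => ((k i).val : ℝ) / L) := by
  intro k k' h
  funext i
  have hi := congr_fun h i
  have hL : (L : ℝ) ≠ 0 := by exact_mod_cast NeZero.ne L
  have : ((k i).val : ℝ) = ((k' i).val : ℝ) := by
    field_simp at hi
    exact_mod_cast hi
  exact ZMod.val_injective L (by exact_mod_cast this)

omit [NeZero L] in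
/-- The band at the attached point is the torus band energy. [folklore] -/
theorem unitCellBand_unitCellPoint (k : TorusSite 2 L) :
    -2 * ∑ i : Fin 2, Real.cos (2 * Real.pi * (((k i).val : ℝ) / L)) = torusBand L k := by
  simp only [torusBand, latticeMomentum]
  congr 1
  refine Finset.sum_congr rfl fun i _ => ?_
  congr 1
  ring

/-- **The sublevel cell meets the lattice `L⁻¹ℤ²` exactly in the attached points of the momenta
counted by `torusLevelCount L E`.** [folklore] -/
theorem image_unitCellPoint_eq (E : ℝ) :
    (fun k : TorusSite 2 L => fun i : Fin 2 => ((k i).val : ℝ) / L) ''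
        {k : TorusSite 2 L | torusBand L k ≤ E} =
      {v : Fin 2 → ℝ | (∀ i, v i ∈ Set.Ico (0 : ℝ) 1) ∧
          -2 * ∑ i : Fin 2, Real.cos (2 * Real.pi * v i) ≤ E} ∩
        (L : ℝ)⁻¹ • ((span ℤ (Set.range (Pi.basisFun ℝ (Fin 2))) : Submodule ℤ (Fin 2 → ℝ))
          : Set (Fin 2 → ℝ)) := by
  have hL : (0 : ℝ) < (L : ℝ) := by exact_mod_cast Nat.pos_of_ne_zero (NeZero.ne L)
  ext v
  simp only [Set.mem_image, Set.mem_setOf_eq, Set.mem_inter_iff]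
  constructor
  · rintro ⟨k, hk, rfl⟩
    refine ⟨⟨fun i => ⟨by positivity, ?_⟩, ?_⟩, ?_⟩
    · rw [div_lt_one hL]
      exact_mod_cast ZMod.val_lt (k i)
    · rw [unitCellBand_unitCellPoint]; exact hk
    · rw [mem_smul_coe_span_iff]
      intro i
      refine ⟨((k i).val : ℤ), ?_⟩
      simp only [eq_intCast, Int.cast_natCast]
      field_simp
  · rintro ⟨⟨hbox, hband⟩, hlat⟩
    rw [mem_smul_coe_span_iff] at hlat
    choose m hm using hlat
    -- `m i = L * v i ∈ [0, L)`
    have hm0 : ∀ i, (0 : ℤ) ≤ m i := fun i => by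
      have h1 : (0 : ℝ) ≤ (L : ℝ) * v i := mul_nonneg hL.le (hbox i).1
      have h2 : ((m i : ℤ) : ℝ) = (L : ℝ) * v i := by simpa using hm i
      exact_mod_cast (h2 ▸ h1 : (0 : ℝ) ≤ ((m i : ℤ) : ℝ))
    have hmL : ∀ i, m i < (L : ℤ) := fun i => by
      have h1 : (L : ℝ) * v i < (L : ℝ) := by nlinarith [(hbox i).2]
      have h2 : ((m i : ℤ) : ℝ) = (L : ℝ) * v i := by simpa using hm i
      exact_mod_cast (h2 ▸ h1 : ((m i : ℤ) : ℝ) < (L : ℝ))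
    refine ⟨fun i => ((m i).toNat : ZMod L), ?_, ?_⟩
    · -- band condition
      have hv : (fun i : Fin 2 => ((((m i).toNat : ZMod L)).val : ℝ) / L) = v := by
        funext i
        rw [ZMod.val_natCast, Nat.mod_eq_of_lt]
        · have h2 : ((m i : ℤ) : ℝ) = (L : ℝ) * v i := by simpa using hm i
          have h3 : (((m i).toNat : ℕ) : ℝ) = ((m i : ℤ) : ℝ) := by
            exact_mod_cast Int.toNat_of_nonneg (hm0 i)
          rw [h3, h2]
          field_simp
        · have := hmL i
          have h0 := hm0 i
          omega
      have := congr_arg (fun w : Fin 2 → ℝ => -2 * ∑ i : Fin 2, Real.cos (2 * Real.pi * w i)) hv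
      rw [← unitCellBand_unitCellPoint]
      exact this ▸ hband
    · funext i
      rw [ZMod.val_natCast, Nat.mod_eq_of_lt]
      · have h2 : ((m i : ℤ) : ℝ) = (L : ℝ) * v i := by simpa using hm i
        have h3 : (((m i).toNat : ℕ) : ℝ) = ((m i : ℤ) : ℝ) := by
          exact_mod_cast Int.toNat_of_nonneg (hm0 i)
        rw [h3, h2]
        field_simp
      · have := hmL i
        have h0 := hm0 i
        omega

/-- **`torusLevelCount L E` counts the points of `L⁻¹ℤ²` in the sublevel cell.** [folklore] -/
theorem card_unitCellSublevel_inter_lattice (E : ℝ) :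
    Nat.card ↥({v : Fin 2 → ℝ | (∀ i, v i ∈ Set.Ico (0 : ℝ) 1) ∧
          -2 * ∑ i : Fin 2, Real.cos (2 * Real.pi * v i) ≤ E} ∩
        (L : ℝ)⁻¹ • ((span ℤ (Set.range (Pi.basisFun ℝ (Fin 2))) : Submodule ℤ (Fin 2 → ℝ))
          : Set (Fin 2 → ℝ))) = torusLevelCount L E := by
  rw [← image_unitCellPoint_eq, Nat.card_coe_set_eq,
    Set.ncard_image_of_injective _ unitCellPoint_injective, torusLevelCount_def,
    Set.ncard_eq_toFinset_card']
  congr 1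
  ext k
  simp

end Lattice

/-! ### The Weyl law -/

/-- **Weyl law for the square-lattice torus band.** For every energy `E`, the fraction of torus
momenta `k ∈ (ℤ/Lℤ)²` with `ε_L(k) ≤ E` converges, as `L → ∞`, to the Lebesgue measure of the
sublevel cell `{v ∈ [0,1)² | -2(cos 2πv₁ + cos 2πv₂) ≤ E}` (the integrated density of states of the
tight-binding band at `E`). Lattice-point counting in a Jordan-measurable set (Mathlib's
`tendsto_card_div_pow_atTop_volume`); the boundary is null because the band's level sets are.
[folklore] -/
theorem tendsto_torusLevelCount_div_sq (E : ℝ) :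
    Tendsto (fun L : ℕ => (torusLevelCount (L + 1) E : ℝ) / (((L + 1 : ℕ) : ℝ) ^ 2)) atTop
      (𝓝 (volume.real {v : Fin 2 → ℝ | (∀ i, v i ∈ Set.Ico (0 : ℝ) 1) ∧
          -2 * ∑ i : Fin 2, Real.cos (2 * Real.pi * v i) ≤ E})) := by
  set s : Set (Fin 2 → ℝ) := {v : Fin 2 → ℝ | (∀ i, v i ∈ Set.Ico (0 : ℝ) 1) ∧
      -2 * ∑ i : Fin 2, Real.cos (2 * Real.pi * v i) ≤ E} with hs
  have hs₁ : IsBounded s := by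
    refine (Metric.isBounded_Icc (0 : Fin 2 → ℝ) 1).subset ?_
    intro v hv
    exact ⟨fun i => (hv.1 i).1, fun i => (hv.1 i).2.le⟩
  have hs₂ : MeasurableSet s := by
    refine MeasurableSet.inter ?_ (measurableSet_le continuous_unitCellBand.measurable measurable_const)
    have : {v : Fin 2 → ℝ | ∀ i, v i ∈ Set.Ico (0 : ℝ) 1} =
        Set.univ.pi fun _ : Fin 2 => Set.Ico (0 : ℝ) 1 := unitCell_eq_pi
    change MeasurableSet {a : Fin 2 → ℝ | ∀ i, a i ∈ Set.Ico (0 : ℝ) 1}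
    rw [this]
    exact MeasurableSet.univ_pi fun _ => measurableSet_Ico
  have hs₃ : volume (frontier s) = 0 := volume_frontier_unitCellSublevel E
  have key := tendsto_card_div_pow_atTop_volume s hs₁ hs₂ hs₃
  have key' := key.comp (tendsto_add_atTop_nat 1)
  refine key'.congr fun L => ?_
  simp only [Function.comp_apply, Fintype.card_fin]
  rw [hs, card_unitCellSublevel_inter_lattice (L := L + 1) E]



end Literature.MathematicalPhysics.QuantumLattice
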